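import Literature.NumberTheory.Weil1964.AdelicDoublingGeometricFrameBorelMp
import Literature.NumberTheory.Automorphic.UnitaryDualPairDoubledLineSumModel
import Literature.NumberTheory.Automorphic.DoubledUnitaryRankOneReductionDiag
import Literature.NumberTheory.Automorphic.UnitaryGroupSplitPlace
import Literature.NumberTheory.Weil1965.ThetaIntegralOrbitFunctionalUnitary
import Literature.NumberTheory.Weil1965.AdelicSiegelFunctionalLinear
import HarnessLib

/-!
# H413 · E-2 · SW2 (iii) — I-CLOSE: THE FRAME OF RECORD at the generality of `hfib` (plumbing for the closed `hfib_CM`)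

Cell `hodgecm-mathlib`, crux H413 (`stmt-HodgeConjecture-24833`), child line `Cruxes/H413/Lines/F0_E2SiegelWeilWeilRange.lean`, stub
`stub_SW2iii_siegelWeil`, identity half.  PROOF lane, `--supports stmt-HodgeConjecture-24833 --as helper`.  Seat F0P4-p01 (g3); row booked
by F0P4-plan (g4) 2026-08-31T05:41:38Z («BUILD B-p03's plumbing lemma `exists_frame_of_record` at hfib's generality»).  KERNEL MATHEMATICS
ONLY (existence theorems by composition of ★ producers; no definition, no `sorry`).  HC_CM is proved only modulo the 7 printed citations until
rung 0 closes; nothing in this file is about Hodge classes.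

WHAT THIS FILE DOES.  ★ (T5) `E2SWIdentityCloseFibreCMFrame.hfib_CM_of_frame` (B-p03 (g23)), ★ A4 `E2SWBorelBoundFrame.exists_borelBound_frame`,
★ A5 `exists_lift_unipotent`, ★ (α) `exists_lift_torus` and ★ (S-1) `hLD_CM` all carry the SAME "frame of record" as named binders:
`[IsGalois F E] (h2 : ∀ σ, σ = 1 ∨ σ = c) (hTW : T_W 0 0 ≠ 0) (hW2) (hTs) (u₀ hu₀) (jS hjS) (j hj) {M} (hM) (E'') (hE'')`.
The closed `hfib_CM` must be proved at the generality of the `hFIB` binder of ★ `E2SWSiegelWeilCM.siegelWeil_weilRange_CM_of_fib` — an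
ARBITRARY quadratic extension of number fields `E = F(δ)` with `c δ = −δ`, CM instances, arbitrary symmetric invertible `T_V`, `T_W` — where
none of these is a hypothesis.  This file DISCHARGES them there, once, by name:

* `conj_ne_one`, `algEquiv_eq_one_or_eq_conj` — `Gal(E/F) = {1, c}` (★ `Automorphic.algEquiv_eq_one_or_eq`);
* `entry_ne_zero_of_isUnit_det_one` — `T_W 0 0 ≠ 0` for an invertible `1 × 1` matrix;
* `isSymm_doubledLine`, `isSymm_adelicGram` — the symmetry letters `hW2`, `hTs`;
* `exists_frame_of_record` — `∃ u₀ jS j M, hu₀ ∧ hjS ∧ hj ∧ hM` from ★ `exists_frameUnipPair` (Weil's frame pair `(v(c₀), t₀)`),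
  ★ `exists_sumModelHom` (the `W`-side hom into the Sum model) and ★ `exists_cayleyTwo` (the `E`-rational Cayley matrix), with `j` the
  hom of record `conj(π u₀ · π(doublingDeltaLift)) ∘ spReindex ∘ jS` (so `hj` is `rfl`);
* `exists_differenceFunctional` — `E″ = Λ_θ − κ₀ · E_X` as ONE `ℂ`-linear functional with its pointwise letter `hE''`.

References: A. Weil, *Sur certains groupes d'opérateurs unitaires*, Acta Math. 111 (1964), Chap. I n° 13 p. 160 [Weil1964]; S. Gelbart,
J. Rogawski, *L-functions and Fourier–Jacobi coefficients for the unitary group U(3)*, Invent. Math. 105 (1991), §3.1 p. 454 [GelbartRogawski1991];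
M. Harris, S. Kudla, W. Sweet, *Theta dichotomy for unitary groups*, J. AMS 9 (1996), §1 (1.11) [HarrisKudlaSweet1996]; A. Weil, *Sur la formule
de Siegel dans la théorie des groupes classiques*, Acta Math. 113 (1965), Chap. IV n° 41 (34) p. 59, n° 52 [Weil1965].
-/

set_option autoImplicit false
-- the cell's `Summit.HodgeConjecture.HodgeConjecture.…` namespace repeats the summit name by design (D-0017 layout)
set_option linter.dupNamespace false

noncomputable section

open MeasureTheory NumberField IsDedekindDomain
open scoped NNReal ENNReal Matrix Kronecker
open Literature.NumberTheory.Automorphic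
open Literature.NumberTheory.Weil1964 Literature.NumberTheory.Weil1965 Literature.NumberTheory.Weil1965.UnitaryDoubling
open Literature.RepresentationTheory.HeisenbergGroup
open Literature.NumberTheory.Automorphic.DoubledUnitary.RankOneReduction
open Literature.NumberTheory.Automorphic.UnitaryGroup
open Literature.NumberTheory.Automorphic.UnitaryGroup.QuadraticCoordinates
open Literature.NumberTheory.GelbartRogawski1991 Literature.NumberTheory.GelbartRogawski1991.UnitaryDualPair

namespace Summit.HodgeConjecture.HodgeConjecture.Cruxes.H413.E2SWFrameOfRecord

/-! ## §1 `Gal(E/F) = {1, c}` for `E = F(δ)`, `c δ = −δ` -/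

section Galois

variable {F E : Type} [Field F] [Field E] [Algebra F E] {c : E ≃ₐ[F] E} {δ : E}

/-- `c ≠ 1`: an automorphism negating a non-zero `δ` is not the identity (characteristic `0`). [folklore] -/
theorem conj_ne_one [CharZero E] (hcδ : c δ = -δ) (hδ : δ ≠ 0) : c ≠ 1 := by
  intro h1
  rw [h1, AlgEquiv.one_apply] at hcδ
  exact hδ (by linear_combination hcδ / 2)

/-- **`Gal(E/F) = {1, c}`**: in the quadratic extension `E = F(δ)` every `F`-automorphism is `1` or the conjugation `c`
(★ `Automorphic.algEquiv_eq_one_or_eq`; separability is automatic in characteristic `0`). [folklore] -/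
theorem algEquiv_eq_one_or_eq_conj [NumberField F] [NumberField E] [Algebra.IsQuadraticExtension F E]
    (hcδ : c δ = -δ) (hδ : δ ≠ 0) : ∀ σ : E ≃ₐ[F] E, σ = 1 ∨ σ = c :=
  fun σ => Literature.NumberTheory.Automorphic.algEquiv_eq_one_or_eq F (conj_ne_one hcδ hδ) σ

/-- **`E/F` is Galois** (quadratic, characteristic `0`; Mathlib `IsQuadraticExtension.isGalois`) — citable for `haveI`. [folklore] -/
theorem isGalois [NumberField F] [Algebra.IsQuadraticExtension F E] : IsGalois F E := inferInstance

end Galois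

/-! ## §2 The matrix letters: `T_W 0 0 ≠ 0`, `hW2`, `hTs` -/

section MatrixLetters

variable {F : Type} [Field F]

/-- an invertible `1 × 1` matrix has non-zero entry (`det T_W = T_W 0 0`). [folklore] -/
theorem entry_ne_zero_of_isUnit_det_one {TW : Matrix (Fin 1) (Fin 1) F} (hWd : IsUnit TW.det) : TW 0 0 ≠ 0 := by
  rw [Matrix.det_fin_one] at hWd
  exact hWd.ne_zero

/-- the doubled line `T_W ⊕ −T_W` (reindexed to `Fin (1+1)`) is symmetric. [cite: GelbartRogawski1991, §3.1 p. 454] -/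
theorem isSymm_doubledLine {TW : Matrix (Fin 1) (Fin 1) F} (hW : TW.IsSymm) :
    (Matrix.reindex finSumFinEquiv finSumFinEquiv (Matrix.fromBlocks TW 0 0 (-TW))).IsSymm :=
  (Matrix.IsSymm.fromBlocks hW (by rw [Matrix.transpose_zero]) hW.neg).submatrix _

/-- the adelic Gram matrix `𝕋 = reindex e e (T_V ⊗ 1 ⊗ₖ T_W ⊗ 1)` is symmetric (`hTs`). [cite: GelbartRogawski1991, §3.1 p. 454] -/
theorem isSymm_adelicGram [NumberField F] {N M n : ℕ} (e : Fin N × Fin M ≃ Fin n)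
    {TV : Matrix (Fin N) (Fin N) F} {TW : Matrix (Fin M) (Fin M) F} (hV : TV.IsSymm) (hW : TW.IsSymm) :
    (adelicGram F e TV TW).IsSymm :=
  (UnitaryGroup.isSymm_kronecker (hV.map _) (hW.map _)).submatrix _

end MatrixLetters

/-! ## §3 The frame of record `(u₀, jS, j, M)` and the difference functional `E″` -/

section Frame

variable (F E : Type) [Field F] [NumberField F] [Field E] [NumberField E] [Algebra F E] [Algebra.IsQuadraticExtension F E]
  (c : E ≃ₐ[F] E) {δ : E} (hcδ : c δ = -δ) (hδ : δ ≠ 0) {d : F} (hd : δ * δ = algebraMap F E d)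
  (N : ℕ) {n : ℕ} (e : Fin N × Fin 1 ≃ Fin n)
  (TV : Matrix (Fin N) (Fin N) F) (hV : TV.IsSymm) (hVd : IsUnit TV.det)
  (TW : Matrix (Fin 1) (Fin 1) F) (hW : TW.IsSymm) (hWd : IsUnit TW.det)
  (hW2 : (Matrix.reindex finSumFinEquiv finSumFinEquiv (Matrix.fromBlocks TW 0 0 (-TW))).IsSymm)
  [MeasurableSpace (AdeleRing (𝓞 F) F)] [BorelSpace (AdeleRing (𝓞 F) F)]
  (νX : Measure (Fin (n + n) → AdeleRing (𝓞 F) F)) [νX.IsAddHaarMeasure]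

include hVd hWd νX in
/-- **THE FRAME OF RECORD EXISTS** at the generality of `hfib`: Weil's frame pair `u₀ ∈ Mp(X□_𝔸)` whose operator IS the frame chirp
(★ `exists_frameUnipPair` at `T := adelicGram F e T_V T_W`), the `W`-side hom `jS : U_D(𝔸_F) →* Sp(𝕋 ⊕ −𝕋)` into the Sum model with
its reading through `spReindex` (★ `exists_sumModelHom`, first conjunct), the HOM OF RECORD `j = conj(π u₀ · π(doublingDeltaLift)) ∘ spReindex ∘ jS`
(by `rfl`), and the `E`-rational Cayley matrix `M = !![1, (2t)⁻¹; 1, −(2t)⁻¹]` (★ `exists_cayleyTwo`) — the binders `u₀ hu₀ jS hjS j hj M hM`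
of ★ A4 `exists_borelBound_frame` ∕ ★ A5 ∕ ★ (α) ∕ ★ `hLD_CM` ∕ ★ (T5) `hfib_CM_of_frame`, VERBATIM, packaged as ONE existential
(the Haar measure `νX` is an argument only because ★ `exists_frameUnipPair` is quoted with it; `hVd hWd` give `IsUnit (det 𝕋)`).
[cite: Weil1964, Chap. I n° 13 p. 160] [cite: GelbartRogawski1991, §3.1 p. 454] [cite: HarrisKudlaSweet1996, §1 (1.11)] -/
theorem exists_frame_of_record (hTW : TW 0 0 ≠ 0) :
    ∃ (u₀ : adelicMpCont F (Fin (n + n)) (doubledGramFin F (adelicGram F e TV TW)))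
      (jS : ↥(UnitaryGroup.adelic F E c (1 + 1)
        ((Matrix.reindex finSumFinEquiv finSumFinEquiv (Matrix.fromBlocks TW 0 0 (-TW))).map (algebraMap F E))) →*
      ↥(symplecticGroup (polar (Matrix.toLinearMap₂' (AdeleRing (𝓞 F) F)
        (Matrix.fromBlocks (adelicGram F e TV TW) 0 0 (-adelicGram F e TV TW))))))
      (j : ↥(UnitaryGroup.adelic F E c (1 + 1)
        ((Matrix.reindex finSumFinEquiv finSumFinEquiv (Matrix.fromBlocks TW 0 0 (-TW))).map (algebraMap F E))) →*
      ↥(symplecticGroup (polar (adelicForm F (Fin (n + n)) (doubledGramFin F (adelicGram F e TV TW))))))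
      (M : GL (Fin 2) (AdeleRing (𝓞 E) E)),
      (∀ Ψ : piSchwartzBruhat F (Fin (n + n)),
      ((adelicMpCont.omega F (Fin (n + n)) (doubledGramFin F (adelicGram F e TV TW)) u₀ Ψ : piSchwartzBruhat F (Fin (n + n))) :
          (Fin (n + n) → AdeleRing (𝓞 F) F) → ℂ) =
        chirp F (ratMatrix F (frameHalfRat F)) (Ψ : (Fin (n + n) → AdeleRing (𝓞 F) F) → ℂ)) ∧
      (∀ (A : ↥(UnitaryGroup.adelic F E c (1 + 1)
        ((Matrix.reindex finSumFinEquiv finSumFinEquiv (Matrix.fromBlocks TW 0 0 (-TW))).map (algebraMap F E))))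
        (v : (Fin (n + n) → AdeleRing (𝓞 F) F) × (Fin (n + n) → AdeleRing (𝓞 F) F)),
      ((spReindex (finSumFinEquiv : Fin n ⊕ Fin n ≃ Fin (n + n))
          (Matrix.fromBlocks (adelicGram F e TV TW) 0 0 (-adelicGram F e TV TW)) (jS A) :
          symplecticGroup (polar (Matrix.toLinearMap₂' (AdeleRing (𝓞 F) F)
            (Matrix.reindex finSumFinEquiv finSumFinEquiv
              (Matrix.fromBlocks (adelicGram F e TV TW) 0 0 (-adelicGram F e TV TW)))))) :
        ((Fin (n + n) → AdeleRing (𝓞 F) F) × (Fin (n + n) → AdeleRing (𝓞 F) F)) ≃ₗ[AdeleRing (𝓞 F) F]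
          ((Fin (n + n) → AdeleRing (𝓞 F) F) × (Fin (n + n) → AdeleRing (𝓞 F) F))) v =
      ((toSp F E c N (1 + 1)
          (((Equiv.prodCongr (Equiv.refl (Fin N)) finSumFinEquiv.symm).trans (Equiv.prodSumDistrib (Fin N) (Fin 1) (Fin 1))).trans
            ((Equiv.sumCongr e e).trans finSumFinEquiv))
          (TV.map (algebraMap F E)) ((Matrix.reindex finSumFinEquiv finSumFinEquiv (Matrix.fromBlocks TW 0 0 (-TW))).map (algebraMap F E))
          hcδ hδ hd hV hW2 rfl rfl
          (adelicInr F E c N (1 + 1) (TV.map (algebraMap F E))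
            ((Matrix.reindex finSumFinEquiv finSumFinEquiv (Matrix.fromBlocks TW 0 0 (-TW))).map (algebraMap F E)) A) :
          symplecticGroup (polar (adelicForm F (Fin (n + n))
            (adelicGram F
              (((Equiv.prodCongr (Equiv.refl (Fin N)) finSumFinEquiv.symm).trans (Equiv.prodSumDistrib (Fin N) (Fin 1) (Fin 1))).trans
                ((Equiv.sumCongr e e).trans finSumFinEquiv)) TV
              (Matrix.reindex finSumFinEquiv finSumFinEquiv (Matrix.fromBlocks TW 0 0 (-TW))))))) :
        ((Fin (n + n) → AdeleRing (𝓞 F) F) × (Fin (n + n) → AdeleRing (𝓞 F) F)) ≃ₗ[AdeleRing (𝓞 F) F]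
          ((Fin (n + n) → AdeleRing (𝓞 F) F) × (Fin (n + n) → AdeleRing (𝓞 F) F))) v) ∧
      (j = (MulAut.conj (adelicMpCont.proj F (Fin (n + n)) (doubledGramFin F (adelicGram F e TV TW)) u₀ *
        adelicMpCont.proj F (Fin (n + n)) (doubledGramFin F (adelicGram F e TV TW))
          (doublingDeltaLift F (adelicGram F e TV TW) (isUnit_det_adelicGram F e hVd hWd)))).toMonoidHom.comp
      ((spReindex (finSumFinEquiv : Fin n ⊕ Fin n ≃ Fin (n + n))
        (Matrix.fromBlocks (adelicGram F e TV TW) 0 0 (-adelicGram F e TV TW))).comp jS)) ∧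
      ((M : Matrix (Fin 2) (Fin 2) (AdeleRing (𝓞 E) E)) =
      !![1, algebraMap E (AdeleRing (𝓞 E) E) (algebraMap F E (2 * TW 0 0)⁻¹);
        1, -algebraMap E (AdeleRing (𝓞 E) E) (algebraMap F E (2 * TW 0 0)⁻¹)]) := by
  have hT : IsUnit (adelicGram F e TV TW).det := isUnit_det_adelicGram F e hVd hWd
  have hu := exists_frameUnipPair F (adelicGram F e TV TW) hT νX
  obtain ⟨u₀, hu₀, -, -⟩ := hu
  have hS := UnitaryGroup.exists_sumModelHom F E c hcδ hδ hd N e TW hV hW2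
  obtain ⟨jS, hjS, -⟩ := hS
  have hC := exists_cayleyTwo F E TW hTW
  obtain ⟨M, -, hM⟩ := hC
  exact ⟨u₀, jS, _, M, hu₀, hjS, rfl, hM⟩

end Frame

section Functional

variable (F E : Type) [Field F] [NumberField F] [Field E] [NumberField E] [Algebra F E] [Algebra.IsQuadraticExtension F E]
  (c : E ≃ₐ[F] E) {δ : E} (hcδ : c δ = -δ) (hδ : δ ≠ 0) {d : F} (hd : δ * δ = algebraMap F E d)
  (N : ℕ) {n : ℕ} (e : Fin N × Fin 1 ≃ Fin n)
  (TV : Matrix (Fin N) (Fin N) F) (hV : TV.IsSymm) (hVd : IsUnit TV.det)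
  (TW : Matrix (Fin 1) (Fin 1) F) (hW : TW.IsSymm) (hWd : IsUnit TW.det)
  [LocallyCompactSpace (UnitaryGroup.adelic F E c N (TV.map (algebraMap F E)))]
  [CompactSpace (UnitaryGroup.adelic F E c N (TV.map (algebraMap F E)) ⧸ (UnitaryGroup.toAdelic F E c N (TV.map (algebraMap F E))).range)]
  [MeasurableSpace (UnitaryGroup.adelic F E c N (TV.map (algebraMap F E)) ⧸ (UnitaryGroup.toAdelic F E c N (TV.map (algebraMap F E))).range)]
  [BorelSpace (UnitaryGroup.adelic F E c N (TV.map (algebraMap F E)) ⧸ (UnitaryGroup.toAdelic F E c N (TV.map (algebraMap F E))).range)]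
  (ν : Measure (UnitaryGroup.adelic F E c N (TV.map (algebraMap F E)) ⧸ (UnitaryGroup.toAdelic F E c N (TV.map (algebraMap F E))).range))
  [IsFiniteMeasure ν]
  [MeasurableSpace (AdeleRing (𝓞 F) F)] [BorelSpace (AdeleRing (𝓞 F) F)]
  (νX : Measure (Fin (n + n) → AdeleRing (𝓞 F) F)) [νX.IsAddHaarMeasure]
  (h : (Fin (n + n) → AdeleRing (𝓞 F) F) → AdeleRing (𝓞 F) F) (hh : Continuous h)

/-- **THE DIFFERENCE FUNCTIONAL `E″ = Λ_θ − κ₀ · E_X` AS ONE `ℂ`-LINEAR MAP** (`κ₀ = ν(univ)`): the `E'' hE''` binders of ★ `hbd_CM` ∕ ★ A4 ∕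
★ (T5), discharged (`Λ_θ` = ★ `thetaOrbitFunctional`, `E_X` = ★ `adelicSiegelFunctionalC`, both `ℂ`-linear).
[cite: Weil1965, Chap. IV n° 41, (34) p. 59] [cite: Weil1965, n° 52] -/
theorem exists_differenceFunctional
    (hB : ∀ Φ ∈ piSchwartzBruhat F (Fin (n + n)), Summable fun ξ : F => ‖adelicSiegelCoeff F (Fin (n + n)) νX h Φ ξ‖) :
    ∃ E'' : piSchwartzBruhat F (Fin (n + n)) →ₗ[ℂ] ℂ,
      ∀ Ψ : piSchwartzBruhat F (Fin (n + n)), E'' Ψ = thetaOrbitFunctional F E c hcδ hδ hd N e TV hV hVd TW hW hWd ν Ψ -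
        ((ν Set.univ).toReal : ℂ) * adelicSiegelFunctionalC F (Fin (n + n)) νX h hh hB Ψ :=
  ⟨thetaOrbitFunctional F E c hcδ hδ hd N e TV hV hVd TW hW hWd ν -
      ((ν Set.univ).toReal : ℂ) • adelicSiegelFunctionalC F (Fin (n + n)) νX h hh hB,
    fun Ψ => by rw [LinearMap.sub_apply, LinearMap.smul_apply, smul_eq_mul]⟩

end Functional

end Summit.HodgeConjecture.HodgeConjecture.Cruxes.H413.E2SWFrameOfRecord

end
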